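import Literature.Analysis.FluidPDE.TorusClassicalNSH2Smoothing
import Mathlib.MeasureTheory.Integral.IntervalIntegral.FundThmCalculus
import HarnessLib

/-!
# Enstrophy inequality and `V`-lifespan of classical Navier–Stokes solutions on `T³`

Analysis/FluidPDE proof file (theorems only; no definitions, no named facts), sequel of
`TorusClassicalH1Balance.lean` (the balance `d/dt ½‖∇u‖₂² = −ν‖Δu‖₂² + ∫ ⟪(u·∇)u − f, Δu⟫`
along classical solutions) and `TorusClassicalNSH2Smoothing.lean` (its flux bound
`Torus.IsClassicalNSSolutionOn.enstrophy_flux_le` on `T³`: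
`−ν‖Δu‖₂² + ∫ ⟪(u·∇)u − f, Δu⟫ ≤ −(ν/2)‖Δu‖₂² + 8K⁴ν⁻³ (‖∇u‖₂²)³ + ½ (‖∇f‖₂² + ‖∇u‖₂²)`).
The main theorem `Torus.IsClassicalNSSolutionOn.enstrophy_lifespan` is the A-PRIORI HALF of the
local existence theorem of strong solutions (Robinson–Rodrigo–Sadowski 2016, Thm 6.8, estimates
(6.7), (6.9), (6.10); Constantin–Foias 1988, Ch. 10, (10.16)), for classical solutions of the
forced system on `T^d × [a, b]`, `card d = 3`, `ν > 0`:

for every level `E₁` of INITIAL enstrophy `‖∇u(a)‖₂² ≤ E₁` and every level `G` of the force,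
`‖∇f(t)‖₂² ≤ G` on `[a, b]`, there are a LIFESPAN `T = T(d, ν, E₁, G) > 0` and a DISSIPATION BUDGET
`Y = Y(ν, E₁)` such that on `[a, min b (a + T)]`

`‖∇u(t)‖₂² ≤ 2E₁ + 1`  and  `∫ₐᵗ ‖Δu(s)‖₂² ds ≤ Y`,

uniformly in `a`, `b`, the solution and the force (in the book, unforced: `T = c‖∇u₀‖⁻⁴`,
`sup ‖∇u‖² ≤ 2‖∇u₀‖²`, `∫₀ᵀ ‖Au‖² ≤ 4‖∇u₀‖²`; here `Y = (2 max(E₁,0) + 1)/ν`). No zero-mean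
hypothesis is needed (the flux bound holds for all classical solutions). These are the constants
of the `V`-theory of strong solutions that depend on `V` / `L²_t H²` quantities only, hence survive
smooth approximation of `V`-data.

Proof (no ODE comparison, a fencing argument instead), `y = ‖∇u‖₂²`, `M = 2E₁ + 1`,
`A = 8K⁴ν⁻³M³ + ½(G + M)` (a bound for `(½y)'` while `y ≤ M`), `T = ½(E₁ + 1)/(A + 1)`:
(i) the affine barrier `B(t) = ½E₁ + (A + 1)(t − a)` stays `≤ ½M` on `[a, a + T]`, and at a
contact point `½y = B` one has `y ≤ M`, so `(½y)' ≤ A < A + 1 = B'`; the fencing lemma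
`image_le_of_deriv_right_lt_deriv_boundary'` gives `½y ≤ B ≤ ½M` on `[a, min b (a + T)]`;
(ii) then `(½y)' ≤ −(ν/2)‖Δu‖₂² + A` there, and the fundamental theorem of calculus in inequality
form (`intervalIntegral.sub_le_integral_of_hasDeriv_right_of_le_Ico`; `t ↦ ‖Δu(t)‖₂²` is
continuous by the `H²` balance `….hasDerivWithinAt_half_integral_norm_laplacian_sq`) gives
`(ν/2) ∫ₐᵗ ‖Δu‖₂² ≤ A(t − a) + ½y(a) ≤ ½M`.
Deliberately NOT here: existence of strong solutions (the Galerkin half of Thm 6.8), uniqueness /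
continuous dependence in `V` (Thm 6.10), the blow-up alternative.

## Mathlib / tree search

Tree (reused): `Torus.IsClassicalNSSolutionOn.hasDerivWithinAt_half_gradNormSq`
(`TorusClassicalH1Balance`), `Torus.IsClassicalNSSolutionOn.enstrophy_flux_le`,
`….hasDerivWithinAt_half_integral_norm_laplacian_sq` (`TorusClassicalNSH2Smoothing`); Mathlib
`image_le_of_deriv_right_lt_deriv_boundary'`, `intervalIntegral.sub_le_integral_of_hasDeriv_right_of_le_Ico`,
`ContinuousOn.intervalIntegrable_of_Icc`. Searched `lifespan|Lifespan`, `enstrophy_flux_le`,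
`2 * E₁ + 1` in the tree: lifespans only for Euler–Galerkin (`EulerFourierGalerkinEnergy.lifespan`),
De Rosa potentials and Tao cascades; no `V`-lifespan of classical torus solutions.

## References

* J. C. Robinson, J. L. Rodrigo, W. Sadowski, *The Three-Dimensional Navier–Stokes Equations*,
  CUP 2016, Thm 6.8 with (6.7), (6.9), (6.10) (book pp. 103–105; held
  `book:robinson2016-three-dimensional-navier-stokes-equations-classical-theory`).
  [RobinsonRodrigoSadowskiCUP2016]
* P. Constantin, C. Foias, *Navier–Stokes Equations*, Univ. Chicago Press 1988, Ch. 10, (10.16).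
  [ConstantinFoiasNSE1988]
-/

noncomputable section

open MeasureTheory Set Function Filter
open scoped ContDiff InnerProductSpace RealInnerProductSpace Topology NNReal

namespace Literature.Analysis.FluidPDE

open Literature.Analysis.FunctionSpaces

variable {d : Type*} [Fintype d] [DecidableEq d]

/-- **Enstrophy inequality and `V`-lifespan of classical Navier–Stokes solutions on `T³`**
(Robinson–Rodrigo–Sadowski 2016, Thm 6.8, the a-priori half: estimates (6.7), (6.9), (6.10), here
with a force). On `T^d` with `card d = 3`, for `ν > 0`, an initial enstrophy level `E₁` and a force
level `G` there are `T > 0` and `Y` such that for EVERY classical solution `(u, p)` of the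
Navier–Stokes system with force `f` on `[a, b] × T^d`, `a < b`, with `‖∇u(a)‖₂² ≤ E₁` and
`‖∇f(t)‖₂² ≤ G` on `[a, b]`: for all `t ∈ [a, b]` with `t ≤ a + T`,
`‖∇u(t)‖₂² ≤ 2E₁ + 1` and `∫ₐᵗ (∫ ‖Δu(s)‖²) ds ≤ Y`. Proof: the `H¹` balance
`hasDerivWithinAt_half_gradNormSq` with the flux bound `enstrophy_flux_le`
(`(½‖∇u‖₂²)' ≤ −(ν/2)‖Δu‖₂² + 8K⁴ν⁻³‖∇u‖₂⁶ + ½(‖∇f‖₂² + ‖∇u‖₂²)`), a fencing argument against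
an affine barrier on `[a, a + T]`, and the fundamental theorem of calculus in inequality form.
[cite: RobinsonRodrigoSadowskiCUP2016, Thm 6.8 (6.7)–(6.10)] -/
theorem _root_.Literature.Analysis.FunctionSpaces.Torus.IsClassicalNSSolutionOn.enstrophy_lifespan
    (hd : Fintype.card d = 3) {ν : ℝ} (hν : 0 < ν) (E₁ G : ℝ) :
    ∃ T : ℝ, 0 < T ∧ ∃ Y : ℝ, ∀ {a b : ℝ} {f u : ℝ → UnitAddTorus d → EuclideanSpace ℝ d}
      {p : ℝ → UnitAddTorus d → ℝ}, Torus.IsClassicalNSSolutionOn (Icc a b) ν f u p → a < b →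
      Torus.gradNormSq (u a) ≤ E₁ → (∀ t ∈ Icc a b, Torus.gradNormSq (f t) ≤ G) →
      (∀ t ∈ Icc a b, t ≤ a + T → Torus.gradNormSq (u t) ≤ 2 * E₁ + 1) ∧
      (∀ t ∈ Icc a b, t ≤ a + T → ∫ s in a..t, (∫ x, ‖Torus.laplacian (u s) x‖ ^ 2) ≤ Y) := by
  obtain ⟨K, hK⟩ := Torus.IsClassicalNSSolutionOn.enstrophy_flux_le (d := d) hd
  -- the constants (all depend on `d, ν, E₁, G` only)
  set E₁' : ℝ := max E₁ 0 with hE₁'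
  set G' : ℝ := max G 0 with hG'
  have hE₁'0 : 0 ≤ E₁' := le_max_right _ _
  have hG'0 : 0 ≤ G' := le_max_right _ _
  set M : ℝ := 2 * E₁' + 1 with hM
  have hM0 : 0 < M := by positivity
  set A : ℝ := 8 * (K : ℝ) ^ 4 / ν ^ 3 * M ^ 3 + 2⁻¹ * (G' + M) with hA
  have hA0 : 0 ≤ A := by positivity
  have hA1 : 0 < A + 1 := by positivity
  have hA1' : A + 1 ≠ 0 := hA1.ne'
  set T : ℝ := 2⁻¹ * (E₁' + 1) / (A + 1) with hT
  have hT0 : 0 < T := by positivity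
  have hAT : (A + 1) * T = 2⁻¹ * (E₁' + 1) := by
    rw [hT]
    field_simp
  refine ⟨T, hT0, M / ν, fun {a b f u p} h hab hEa hG => ?_⟩
  have hE₁0 : 0 ≤ E₁ := (Torus.gradNormSq_nonneg _).trans hEa
  have hE₁'eq : E₁' = E₁ := max_eq_left hE₁0
  -- notation for the enstrophy, its flux and the dissipation along the solution
  set Eh : ℝ → ℝ := fun s => 2⁻¹ * Torus.gradNormSq (u s) with hEh
  set P : ℝ → ℝ := fun s => ∫ x, ‖Torus.laplacian (u s) x‖ ^ 2 with hP
  set Eh' : ℝ → ℝ := fun s => -ν * (∫ x, ‖Torus.laplacian (u s) x‖ ^ 2) +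
    ∫ x, ⟪Torus.convect (u s) (u s) x - f s x, Torus.laplacian (u s) x⟫ with hEh'
  have hP0 : ∀ s, 0 ≤ P s := fun s => integral_nonneg fun x => sq_nonneg _
  have hEh0 : ∀ s, 0 ≤ Eh s := fun s => mul_nonneg (by norm_num) (Torus.gradNormSq_nonneg _)
  have hEha : Eh a ≤ 2⁻¹ * E₁' :=
    mul_le_mul_of_nonneg_left (hEa.trans (le_max_left _ _)) (by norm_num)
  have hG'' : ∀ s ∈ Icc a b, Torus.gradNormSq (f s) ≤ G' := fun s hs =>
    (hG s hs).trans (le_max_left _ _)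
  -- the `H¹` balance, and its flux bound while the enstrophy is `≤ M`
  have hdE : ∀ s ∈ Icc a b, HasDerivWithinAt Eh (Eh' s) (Icc a b) s := fun s hs =>
    h.hasDerivWithinAt_half_gradNormSq hab hs
  have hflux : ∀ s ∈ Icc a b, Torus.gradNormSq (u s) ≤ M → Eh' s ≤ -(ν / 2) * P s + A := by
    intro s hs hsM
    have h0 := Torus.gradNormSq_nonneg (u s)
    have h6 : 8 * (K : ℝ) ^ 4 / ν ^ 3 * Torus.gradNormSq (u s) ^ 3 ≤
        8 * (K : ℝ) ^ 4 / ν ^ 3 * M ^ 3 :=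
      mul_le_mul_of_nonneg_left (pow_le_pow_left₀ h0 hsM 3) (by positivity)
    calc Eh' s ≤ -(ν / 2) * P s + (8 * (K : ℝ) ^ 4 / ν ^ 3 * Torus.gradNormSq (u s) ^ 3 +
          2⁻¹ * (Torus.gradNormSq (f s) + Torus.gradNormSq (u s))) := hK ν hν h hab hs
      _ ≤ -(ν / 2) * P s + A := by rw [hA]; linarith [h6, hsM, hG'' s hs]
  -- the dissipation `s ↦ ‖Δu(s)‖₂²` is continuous on `[a, b]` (from the `H²` balance)
  have hPc : ContinuousOn P (Icc a b) := by
    have h2 : ContinuousOn (fun s => 2⁻¹ * P s) (Icc a b) := fun s hs =>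
      (h.hasDerivWithinAt_half_integral_norm_laplacian_sq hab hs).continuousWithinAt
    refine ((continuousOn_const (c := (2 : ℝ))).mul h2).congr fun s _ => ?_
    show P s = 2 * (2⁻¹ * P s)
    ring
  -- Step 1: fencing on `[a, b']`, `b' = min b (a + T)`, against `B(s) = ½E₁' + (A + 1)(s - a)`
  set b' : ℝ := min b (a + T) with hb'
  have hb'b : b' ≤ b := min_le_left _ _
  have hb'T : b' ≤ a + T := min_le_right _ _
  have hsub : Icc a b' ⊆ Icc a b := Icc_subset_Icc le_rfl hb'b
  have hEhc : ContinuousOn Eh (Icc a b') := fun s hs =>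
    ((hdE s (hsub hs)).continuousWithinAt).mono hsub
  have hEhr : ∀ s ∈ Ico a b', HasDerivWithinAt Eh (Eh' s) (Ici s) s := fun s hs =>
    ((hdE s (hsub (Ico_subset_Icc_self hs))).mono
      (Icc_subset_Icc hs.1 le_rfl)).mono_of_mem_nhdsWithin (Icc_mem_nhdsGE (hs.2.trans_le hb'b))
  have hfence := image_le_of_deriv_right_lt_deriv_boundary' hEhc hEhr
    (B := fun s => 2⁻¹ * E₁' + (A + 1) * (s - a)) (B' := fun _ => A + 1)
    (by simpa only [sub_self, mul_zero, add_zero] using hEha)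
    (by fun_prop)
    (fun s _ => by
      have h1 : HasDerivWithinAt (fun r => 2⁻¹ * E₁' + (A + 1) * (r - a)) (0 + (A + 1) * (1 - 0))
          (Ici s) s :=
        (hasDerivWithinAt_const _ _ _).add (((hasDerivWithinAt_id _ _).sub
          (hasDerivWithinAt_const _ _ _)).const_mul (A + 1))
      simpa using h1)
    (fun s hs heq => by
      -- at a contact point the enstrophy is `≤ M`, so the flux is `≤ A < A + 1`
      have h1 : (A + 1) * (s - a) ≤ (A + 1) * T :=
        mul_le_mul_of_nonneg_left (by linarith [hs.2, hb'T]) hA1.le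
      have h2 : Eh s = 2⁻¹ * Torus.gradNormSq (u s) := rfl
      have hsM : Torus.gradNormSq (u s) ≤ M := by
        rw [hM]
        linarith [heq, h1, hAT, h2]
      have h4 := hflux s (hsub (Ico_subset_Icc_self hs)) hsM
      have h5 : 0 ≤ ν / 2 * P s := mul_nonneg (by positivity) (hP0 s)
      show Eh' s < A + 1
      linarith)
  have hyM : ∀ s ∈ Icc a b', Torus.gradNormSq (u s) ≤ M := by
    intro s hs
    have h1 : Eh s ≤ 2⁻¹ * E₁' + (A + 1) * (s - a) := hfence hs
    have h2 : (A + 1) * (s - a) ≤ (A + 1) * T :=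
      mul_le_mul_of_nonneg_left (by linarith [hs.2, hb'T]) hA1.le
    have h3 : Eh s = 2⁻¹ * Torus.gradNormSq (u s) := rfl
    rw [hM]
    linarith [hAT]
  refine ⟨fun t ht htT => ?_, fun t ht htT => ?_⟩
  · -- (i) the enstrophy bound
    have htb' : t ∈ Icc a b' := ⟨ht.1, le_min ht.2 htT⟩
    have h1 := hyM t htb'
    rw [hM, hE₁'eq] at h1
    exact h1
  · -- (ii) the dissipation budget: integrate `(½y)' ≤ -(ν/2) P + A` over `[a, t]`
    have htb' : t ∈ Icc a b' := ⟨ht.1, le_min ht.2 htT⟩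
    have hsubt : Icc a t ⊆ Icc a b' := Icc_subset_Icc le_rfl htb'.2
    have hPct : ContinuousOn P (Icc a t) := hPc.mono (hsubt.trans hsub)
    have hφi : IntegrableOn (fun s => -(ν / 2) * P s + A) (Icc a t) volume :=
      ((continuousOn_const.mul hPct).add continuousOn_const).integrableOn_Icc
    have hEhr' : ∀ s ∈ Ico a t, HasDerivWithinAt Eh (Eh' s) (Ioi s) s := fun s hs =>
      (hEhr s ⟨hs.1, hs.2.trans_le htb'.2⟩).mono Ioi_subset_Ici_self
    have hφg : ∀ s ∈ Ico a t, Eh' s ≤ -(ν / 2) * P s + A := fun s hs =>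
      hflux s (hsub (hsubt (Ico_subset_Icc_self hs)))
        (hyM s (hsubt (Ico_subset_Icc_self hs)))
    have hmain := intervalIntegral.sub_le_integral_of_hasDeriv_right_of_le_Ico ht.1
      (hEhc.mono hsubt) hEhr' hφi hφg
    have hPi : IntervalIntegrable P volume a t := hPct.intervalIntegrable_of_Icc ht.1
    have hsplit : ∫ s in a..t, (-(ν / 2) * P s + A) =
        -(ν / 2) * (∫ s in a..t, P s) + (t - a) * A := by
      rw [intervalIntegral.integral_add (hPi.const_mul _) intervalIntegrable_const,
        intervalIntegral.integral_const_mul, intervalIntegral.integral_const, smul_eq_mul]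
    rw [hsplit] at hmain
    have h3 : (t - a) * A ≤ T * A := mul_le_mul_of_nonneg_right (by linarith [htT]) hA0
    have h4 : ν / 2 * (∫ s in a..t, P s) ≤ 2⁻¹ * M := by
      rw [hM]
      linarith [hmain, h3, hEha, hEh0 t, hAT, hT0]
    rw [le_div_iff₀ hν]
    linarith [h4]

end Literature.Analysis.FluidPDE

end
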